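import Summits.ValiantsHypothesis.ValiantsHypothesis.Theorems.LacunarySymmetroidMatrixDescartesDoorA26WallBubblingMixGram

/-!
# Wall bubbling for `DoorA26` — WEYL QUINTUPLES: the constrained limit Gram of a five-letter frame has an invertible principal `3 × 3` minor

HONEST FRAMING.  Chain lemma toward `TripleStratum26` of `Cruxes/DoorA26/Lines/wall_bubbling_ConfluentDoor.lean` (rev 13; crux `DoorA26`,
stmt-ValiantsHypothesis-19979 — OPEN, typed, never asserted), pattern [5,1].  W1 seat val-sym-door-p2 g15 (#100).  FINITE-DIMENSIONAL REAL ALGEBRA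
ONLY (def-free): the case analysis of the five-letter rigidity dichotomy (#101 `…WeylQuintDichotomy`), isolated.

At a normalised cluster limit of a Weyl quintuple whose fifteenth function-level slot is alive, the limit Gram `β = lim G/‖G‖` of the frame
`T₀..T₄` satisfies the nine HEAD CONSTRAINTS (`M₀..M₈ = o(‖G‖)`): `β₀₀ = β₀₁ = 0`, `β₁₁ = −β₀₂`, `3β₁₂ = −β₀₃`, `β₀₄ + 4β₁₃ + 3β₂₂ = 0`,
`β₁₄ + 2β₂₃ = 0`, `3β₂₄ + 2β₃₃ = 0`, `β₃₄ = β₄₄ = 0` — a six-parameter family `(X,Y,U,Z,V,W) = (β₀₂,β₀₃,β₀₄,β₁₃,β₁₄,β₂₄)` — it is `≠ 0`, and it has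
TWO Plücker-normalised kernel vectors (five letters in the 3-space `Sym₂(ℝ)`, #99 `symm_frame_two_kernel`).

* `quint_kernel_minor_*` — in the residual family `X = W = 0`, `U = −4Z`, `YVZ = 0` every kernel vector is a multiple of ONE fixed vector (four
  sub-cases, each by `linear_combination`), so
* **`quint_rigidity_minor`** — some principal `3 × 3` minor of `β` is invertible: `{0,1,2} = X³`, `{2,3,4} = (3/2)W³`, `{0,2,4} = −aU²`, `{0,2,3} = −aY²`,
  `{1,2,4} = −aV²`, `{1,2,3} = YVZ/3 − aZ²` (`a = −(U+4Z)/3`), and the residual family is excluded because two kernel vectors with a unit `2 × 2` minor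
  cannot both be multiples of one vector.

USE (#101): #85's Schur bound on that sub-frame kills the pure class of the single letter.  Nothing here bears on `DoorA26`, `MatrixDescartes`
(stmt-ValiantsHypothesis-18050) or `VP ≠ VNP`; `TripleStratum26`, (W), (M) OPEN.  `--supports stmt-ValiantsHypothesis-19979 --as helper`.  [this work].
-/

-- `Summit.ValiantsHypothesis.ValiantsHypothesis.…` repeats a component by the D-0017 layout
-- (single-conjunct summit), which the `dupNamespace` linter flags; the name is mandated.
set_option linter.dupNamespace false

namespace Summit.ValiantsHypothesis.ValiantsHypothesis.Theorems.LacunarySymmetroidMatrixDescartes.WallBubbling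

open Finset
open scoped BigOperators

/-! ## 1. Two vectors proportional to a third have vanishing `2 × 2` minors -/

/-- If `r·c = s·v` and `r·d = t·v` entrywise with `r ≠ 0`, every `2 × 2` minor of `(c, d)` vanishes. [folklore] -/
theorem minors_eq_zero_of_prop (r s t : ℝ) (hr : r ≠ 0) (v c d : Fin 5 → ℝ)
    (hc : ∀ k, r * c k = s * v k) (hd : ∀ k, r * d k = t * v k) (i j : Fin 5) : c i * d j - c j * d i = 0 := by
  have h : r * r * (c i * d j - c j * d i) = (r * c i) * (r * d j) - (r * c j) * (r * d i) := by ring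
  rw [hc, hc, hd, hd] at h
  have h2 : r * r * (c i * d j - c j * d i) = 0 := by rw [h]; ring
  rcases mul_eq_zero.mp h2 with h3 | h3
  · exact absurd (mul_self_eq_zero.mp h3) hr
  · exact h3

/-! ## 2. The residual family: every kernel vector is a multiple of one vector -/

/-- Residual sub-case `Y = 0`, `Z ≠ 0` (`X = W = 0`, `U = −4Z`): kernel vectors are multiples of `(V², 4ZV, 8Z², 0, 0)`. [this work] -/
theorem quint_kernel_minor_A1 (Z V : ℝ) (c : Fin 5 → ℝ)
    (h0 : -(4 : ℝ) * Z * c 4 = 0) (h1 : Z * c 3 + V * c 4 = 0) (h3 : Z * c 1 - V / 2 * c 2 = 0) (h4 : -(4 : ℝ) * Z * c 0 + V * c 1 = 0) :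
    ∀ k, 8 * Z ^ 2 * c k = c 2 * (![V ^ 2, 4 * Z * V, 8 * Z ^ 2, 0, 0] : Fin 5 → ℝ) k := by
  intro k
  fin_cases k
  · show 8 * Z ^ 2 * c 0 = c 2 * V ^ 2
    linear_combination (-2 * Z) * h4 + (2 * V) * h3
  · show 8 * Z ^ 2 * c 1 = c 2 * (4 * Z * V)
    linear_combination (8 * Z) * h3
  · show 8 * Z ^ 2 * c 2 = c 2 * (8 * Z ^ 2)
    ring
  · show 8 * Z ^ 2 * c 3 = c 2 * 0
    linear_combination (8 * Z) * h1 + (2 * V) * h0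
  · show 8 * Z ^ 2 * c 4 = c 2 * 0
    linear_combination (-2 * Z) * h0

/-- Residual sub-case `Y = Z = 0`, `V ≠ 0` (`X = W = U = 0`): kernel vectors are multiples of `(V, 0, 0, 0, 0)`. [this work] -/
theorem quint_kernel_minor_A2 (V : ℝ) (c : Fin 5 → ℝ)
    (h1 : V * c 4 = 0) (h2 : -(V / 2) * c 3 = 0) (h3 : -(V / 2) * c 2 = 0) (h4 : V * c 1 = 0) :
    ∀ k, V * c k = c 0 * (![V, 0, 0, 0, 0] : Fin 5 → ℝ) k := by
  intro k
  fin_cases k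
  · show V * c 0 = c 0 * V
    ring
  · show V * c 1 = c 0 * 0
    linear_combination h4
  · show V * c 2 = c 0 * 0
    linear_combination (-2) * h3
  · show V * c 3 = c 0 * 0
    linear_combination (-2) * h2
  · show V * c 4 = c 0 * 0
    linear_combination h1

/-- Residual sub-case `Y ≠ 0`, `V = 0` (`X = W = 0`, `U = −4Z`): kernel vectors are multiples of `(0, 0, 12Z², 4ZY, Y²)`. [this work] -/
theorem quint_kernel_minor_B1 (Y Z : ℝ) (c : Fin 5 → ℝ)
    (h0 : Y * c 3 - 4 * Z * c 4 = 0) (h1 : -(Y / 3) * c 2 + Z * c 3 = 0) (h2 : -(Y / 3) * c 1 = 0) (h3 : Y * c 0 + Z * c 1 = 0) :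
    ∀ k, Y ^ 2 * c k = c 4 * (![0, 0, 12 * Z ^ 2, 4 * Z * Y, Y ^ 2] : Fin 5 → ℝ) k := by
  intro k
  fin_cases k
  · show Y ^ 2 * c 0 = c 4 * 0
    linear_combination Y * h3 + (3 * Z) * h2
  · show Y ^ 2 * c 1 = c 4 * 0
    linear_combination (-3 * Y) * h2
  · show Y ^ 2 * c 2 = c 4 * (12 * Z ^ 2)
    linear_combination (-3 * Y) * h1 + (3 * Z) * h0
  · show Y ^ 2 * c 3 = c 4 * (4 * Z * Y)
    linear_combination Y * h0
  · show Y ^ 2 * c 4 = c 4 * Y ^ 2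
    ring

/-- Residual sub-case `Y ≠ 0`, `V ≠ 0`, `Z = 0` (`X = W = U = 0`): kernel vectors are multiples of `(3V², 0, 6VY, 0, 2Y²)`. [this work] -/
theorem quint_kernel_minor_B2 (Y V : ℝ) (c : Fin 5 → ℝ)
    (h0 : Y * c 3 = 0) (h1 : -(Y / 3) * c 2 + V * c 4 = 0) (h2 : -(Y / 3) * c 1 - V / 2 * c 3 = 0) (h3 : Y * c 0 - V / 2 * c 2 = 0) :
    ∀ k, 2 * Y ^ 2 * c k = c 4 * (![3 * V ^ 2, 0, 6 * V * Y, 0, 2 * Y ^ 2] : Fin 5 → ℝ) k := by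
  intro k
  fin_cases k
  · show 2 * Y ^ 2 * c 0 = c 4 * (3 * V ^ 2)
    linear_combination (2 * Y) * h3 - (3 * V) * h1
  · show 2 * Y ^ 2 * c 1 = c 4 * 0
    linear_combination (-6 * Y) * h2 - (3 * V) * h0
  · show 2 * Y ^ 2 * c 2 = c 4 * (6 * V * Y)
    linear_combination (-6 * Y) * h1
  · show 2 * Y ^ 2 * c 3 = c 4 * 0
    linear_combination (2 * Y) * h0
  · show 2 * Y ^ 2 * c 4 = c 4 * (2 * Y ^ 2)
    ring

/-! ## 3. The invertible principal minor -/

/-- **THE CONSTRAINED LIMIT GRAM OF A FIVE-LETTER FRAME HAS AN INVERTIBLE PRINCIPAL `3 × 3` MINOR.**  See the module docstring. [this work] -/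
theorem quint_rigidity_minor (β : Fin 5 × Fin 5 → ℝ) (hsymm : ∀ i j, β (i, j) = β (j, i))
    (h00 : β (0, 0) = 0) (h01 : β (0, 1) = 0) (h0211 : β (0, 2) + β (1, 1) = 0) (h0312 : β (0, 3) + 3 * β (1, 2) = 0)
    (h041322 : β (0, 4) + 4 * β (1, 3) + 3 * β (2, 2) = 0) (h1423 : β (1, 4) + 2 * β (2, 3) = 0)
    (h2433 : 3 * β (2, 4) + 2 * β (3, 3) = 0) (h34 : β (3, 4) = 0) (h44 : β (4, 4) = 0)
    (hne : ∃ ij, β ij ≠ 0)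
    (c d : Fin 5 → ℝ) (hc : ∀ j, ∑ i, c i * β (j, i) = 0) (hd : ∀ j, ∑ i, d i * β (j, i) = 0)
    (hcd : ∃ i j, c i = 1 ∧ c j = 0 ∧ d i = 0 ∧ d j = 1) :
    ∃ e : Fin 3 → Fin 5, (Matrix.of fun i j : Fin 3 => β (e i, e j)).det ≠ 0 := by
  -- the six parameters and the entries
  have e10 : β (1, 0) = 0 := by rw [hsymm]; exact h01
  have e11 : β (1, 1) = -β (0, 2) := by linarith
  have e12 : β (1, 2) = -β (0, 3) / 3 := by linarith
  have e20 : β (2, 0) = β (0, 2) := hsymm 2 0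
  have e21 : β (2, 1) = -β (0, 3) / 3 := by rw [hsymm]; exact e12
  have e22 : β (2, 2) = -(β (0, 4) + 4 * β (1, 3)) / 3 := by linarith
  have e23 : β (2, 3) = -β (1, 4) / 2 := by linarith
  have e30 : β (3, 0) = β (0, 3) := hsymm 3 0
  have e31 : β (3, 1) = β (1, 3) := hsymm 3 1
  have e32 : β (3, 2) = -β (1, 4) / 2 := by rw [hsymm]; exact e23
  have e33 : β (3, 3) = -(3 * β (2, 4)) / 2 := by linarith
  have e40 : β (4, 0) = β (0, 4) := hsymm 4 0
  have e41 : β (4, 1) = β (1, 4) := hsymm 4 1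
  have e42 : β (4, 2) = β (2, 4) := hsymm 4 2
  have e43 : β (4, 3) = 0 := by rw [hsymm]; exact h34
  -- the kernel equations written out
  have hrow : ∀ u : Fin 5 → ℝ, (∀ j, ∑ i, u i * β (j, i) = 0) →
      (β (0, 2) * u 2 + β (0, 3) * u 3 + β (0, 4) * u 4 = 0) ∧
      (-β (0, 2) * u 1 - β (0, 3) / 3 * u 2 + β (1, 3) * u 3 + β (1, 4) * u 4 = 0) ∧
      (β (0, 2) * u 0 - β (0, 3) / 3 * u 1 - (β (0, 4) + 4 * β (1, 3)) / 3 * u 2 - β (1, 4) / 2 * u 3 + β (2, 4) * u 4 = 0) ∧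
      (β (0, 3) * u 0 + β (1, 3) * u 1 - β (1, 4) / 2 * u 2 - 3 * β (2, 4) / 2 * u 3 = 0) ∧
      (β (0, 4) * u 0 + β (1, 4) * u 1 + β (2, 4) * u 2 = 0) := by
    intro u hu
    have r0 := hu 0
    have r1 := hu 1
    have r2 := hu 2
    have r3 := hu 3
    have r4 := hu 4
    simp only [Fin.sum_univ_five, h00, h01, e10, e11, e12, e20, e21, e22, e23, e30, e31, e32, e33, e40, e41, e42, e43, h34, h44] at r0 r1 r2 r3 r4
    refine ⟨by linear_combination r0, by linear_combination r1, by linear_combination r2, by linear_combination r3, by linear_combination r4⟩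
  obtain ⟨c0, c1, c2, c3, c4⟩ := hrow c hc
  obtain ⟨d0, d1, d2, d3, d4⟩ := hrow d hd
  obtain ⟨i₀, j₀, hci, hcj, hdi, hdj⟩ := hcd
  have hminor : c i₀ * d j₀ - c j₀ * d i₀ ≠ 0 := by rw [hci, hcj, hdi, hdj]; norm_num
  -- principal minors
  have d012 : (Matrix.of fun i j : Fin 3 => β ((![0, 1, 2] : Fin 3 → Fin 5) i, (![0, 1, 2] : Fin 3 → Fin 5) j)).det = β (0, 2) ^ 3 := by
    rw [Matrix.det_fin_three]
    simp only [Matrix.of_apply, Matrix.cons_val_zero, Matrix.cons_val_one, Matrix.cons_val_two, Matrix.head_cons, Matrix.tail_cons,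
      h00, h01, e10, e11, e12, e20, e21, e22]
    ring
  have d234 : (Matrix.of fun i j : Fin 3 => β ((![2, 3, 4] : Fin 3 → Fin 5) i, (![2, 3, 4] : Fin 3 → Fin 5) j)).det = 3 / 2 * β (2, 4) ^ 3 := by
    rw [Matrix.det_fin_three]
    simp only [Matrix.of_apply, Matrix.cons_val_zero, Matrix.cons_val_one, Matrix.cons_val_two, Matrix.head_cons, Matrix.tail_cons,
      e22, e23, e32, e33, e42, e43, h34, h44]
    ring
  have d024 : (Matrix.of fun i j : Fin 3 => β ((![0, 2, 4] : Fin 3 → Fin 5) i, (![0, 2, 4] : Fin 3 → Fin 5) j)).det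
      = 2 * β (0, 2) * β (2, 4) * β (0, 4) + (β (0, 4) + 4 * β (1, 3)) / 3 * β (0, 4) ^ 2 := by
    rw [Matrix.det_fin_three]
    simp only [Matrix.of_apply, Matrix.cons_val_zero, Matrix.cons_val_one, Matrix.cons_val_two, Matrix.head_cons, Matrix.tail_cons,
      h00, e20, e22, e40, e42, h44]
    ring
  have d023 : (Matrix.of fun i j : Fin 3 => β ((![0, 2, 3] : Fin 3 → Fin 5) i, (![0, 2, 3] : Fin 3 → Fin 5) j)).det
      = 3 / 2 * β (2, 4) * β (0, 2) ^ 2 - β (1, 4) * β (0, 2) * β (0, 3) + (β (0, 4) + 4 * β (1, 3)) / 3 * β (0, 3) ^ 2 := by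
    rw [Matrix.det_fin_three]
    simp only [Matrix.of_apply, Matrix.cons_val_zero, Matrix.cons_val_one, Matrix.cons_val_two, Matrix.head_cons, Matrix.tail_cons,
      h00, e20, e22, e23, e30, e32, e33]
    ring
  have d124 : (Matrix.of fun i j : Fin 3 => β ((![1, 2, 4] : Fin 3 → Fin 5) i, (![1, 2, 4] : Fin 3 → Fin 5) j)).det
      = -β (0, 2) * (-(β (2, 4) ^ 2)) + β (0, 3) / 3 * (-(β (2, 4) * β (1, 4))) + β (1, 4) * (-β (0, 3) / 3 * β (2, 4) + (β (0, 4) + 4 * β (1, 3)) / 3 * β (1, 4)) := by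
    rw [Matrix.det_fin_three]
    simp only [Matrix.of_apply, Matrix.cons_val_zero, Matrix.cons_val_one, Matrix.cons_val_two, Matrix.head_cons, Matrix.tail_cons,
      e11, e12, e21, e22, e41, e42, h44]
    ring
  have d123 : (Matrix.of fun i j : Fin 3 => β ((![1, 2, 3] : Fin 3 → Fin 5) i, (![1, 2, 3] : Fin 3 → Fin 5) j)).det
      = -β (0, 2) * (-(β (0, 4) + 4 * β (1, 3)) / 3 * (-(3 * β (2, 4)) / 2) - β (1, 4) ^ 2 / 4)
        + β (0, 3) / 3 * (-β (0, 3) / 3 * (-(3 * β (2, 4)) / 2) + β (1, 4) / 2 * β (1, 3))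
        + β (1, 3) * (β (0, 3) / 3 * β (1, 4) / 2 + (β (0, 4) + 4 * β (1, 3)) / 3 * β (1, 3)) := by
    rw [Matrix.det_fin_three]
    simp only [Matrix.of_apply, Matrix.cons_val_zero, Matrix.cons_val_one, Matrix.cons_val_two, Matrix.head_cons, Matrix.tail_cons,
      e11, e12, e21, e22, e23, e31, e32, e33]
    ring
  -- the case tree
  by_cases hX : β (0, 2) ≠ 0
  · exact ⟨![0, 1, 2], by rw [d012]; exact pow_ne_zero 3 hX⟩
  push Not at hX
  by_cases hW : β (2, 4) ≠ 0
  · exact ⟨![2, 3, 4], by rw [d234]; exact mul_ne_zero (by norm_num) (pow_ne_zero 3 hW)⟩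
  push Not at hW
  by_cases ha : β (0, 4) + 4 * β (1, 3) ≠ 0
  · by_cases hU : β (0, 4) ≠ 0
    · refine ⟨![0, 2, 4], ?_⟩
      rw [d024, hX, hW]
      have : (β (0, 4) + 4 * β (1, 3)) / 3 * β (0, 4) ^ 2 ≠ 0 := mul_ne_zero (div_ne_zero ha (by norm_num)) (pow_ne_zero 2 hU)
      simpa using this
    push Not at hU
    by_cases hY : β (0, 3) ≠ 0
    · refine ⟨![0, 2, 3], ?_⟩
      rw [d023, hX, hW]
      have : (β (0, 4) + 4 * β (1, 3)) / 3 * β (0, 3) ^ 2 ≠ 0 := mul_ne_zero (div_ne_zero ha (by norm_num)) (pow_ne_zero 2 hY)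
      simpa using this
    push Not at hY
    by_cases hV : β (1, 4) ≠ 0
    · refine ⟨![1, 2, 4], ?_⟩
      rw [d124, hX, hW, hY]
      have : (β (0, 4) + 4 * β (1, 3)) / 3 * β (1, 4) ^ 2 ≠ 0 := mul_ne_zero (div_ne_zero ha (by norm_num)) (pow_ne_zero 2 hV)
      intro h0; apply this; linear_combination h0
    push Not at hV
    have hZ : β (1, 3) ≠ 0 := by intro h0; apply ha; rw [hU, h0]; ring
    refine ⟨![1, 2, 3], ?_⟩
    rw [d123, hX, hW, hY, hV, hU]
    have : (4 * β (1, 3)) / 3 * β (1, 3) ^ 2 ≠ 0 := mul_ne_zero (div_ne_zero (mul_ne_zero (by norm_num) hZ) (by norm_num)) (pow_ne_zero 2 hZ)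
    intro h0; apply this; linear_combination h0
  push Not at ha
  have hU : β (0, 4) = -4 * β (1, 3) := by linarith
  by_cases hYVZ : β (0, 3) * β (1, 4) * β (1, 3) ≠ 0
  · refine ⟨![1, 2, 3], ?_⟩
    rw [d123, hX, hW, hU]
    have : β (0, 3) * β (1, 4) * β (1, 3) / 3 ≠ 0 := div_ne_zero hYVZ (by norm_num)
    intro h0; apply this; linear_combination h0
  push Not at hYVZ
  -- the residual family: both kernel vectors are multiples of one vector — contradiction with the unit minor
  exfalso
  -- rewrite the kernel equations in the residual family
  simp only [hX, hW, hU] at c0 c1 c2 c3 c4 d0 d1 d2 d3 d4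
  by_cases hY : β (0, 3) = 0
  · by_cases hZ : β (1, 3) = 0
    · -- A2: `Y = Z = 0`; then `V ≠ 0` (else `β = 0`)
      have hV : β (1, 4) ≠ 0 := by
        intro hV
        obtain ⟨⟨i, j⟩, hij⟩ := hne
        apply hij
        have hvals : β (0, 0) = 0 ∧ β (0, 1) = 0 ∧ β (0, 2) = 0 ∧ β (0, 3) = 0 ∧ β (0, 4) = 0 ∧ β (1, 1) = 0 ∧ β (1, 2) = 0 ∧
            β (1, 3) = 0 ∧ β (1, 4) = 0 ∧ β (2, 2) = 0 ∧ β (2, 3) = 0 ∧ β (2, 4) = 0 ∧ β (3, 3) = 0 ∧ β (3, 4) = 0 ∧ β (4, 4) = 0 :=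
          ⟨h00, h01, hX, hY, by rw [hU, hZ]; ring, by rw [e11, hX]; ring, by rw [e12, hY]; ring, hZ, hV, by rw [e22, hU, hZ]; ring,
            by rw [e23, hV]; ring, hW, by rw [e33, hW]; ring, h34, h44⟩
        obtain ⟨v00, v01, v02, v03, v04, v11, v12, v13, v14, v22, v23, v24, v33, v34, v44⟩ := hvals
        have h5 : ∀ i : Fin 5, i = 0 ∨ i = 1 ∨ i = 2 ∨ i = 3 ∨ i = 4 := by decide
        rcases h5 i with rfl | rfl | rfl | rfl | rfl <;> rcases h5 j with rfl | rfl | rfl | rfl | rfl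
        all_goals first | assumption | (rw [hsymm]; assumption)
      simp only [hY, hZ] at c1 c2 c3 c4 d1 d2 d3 d4
      have kc := quint_kernel_minor_A2 (β (1, 4)) c (by linear_combination c1) (by linear_combination c2) (by linear_combination c3)
        (by linear_combination c4)
      have kd := quint_kernel_minor_A2 (β (1, 4)) d (by linear_combination d1) (by linear_combination d2) (by linear_combination d3)
        (by linear_combination d4)
      exact hminor (minors_eq_zero_of_prop _ _ _ hV _ c d kc kd i₀ j₀)
    · -- A1: `Y = 0`, `Z ≠ 0`
      simp only [hY] at c0 c1 c3 c4 d0 d1 d3 d4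
      have kc := quint_kernel_minor_A1 (β (1, 3)) (β (1, 4)) c (by linear_combination c0) (by linear_combination c1)
        (by linear_combination c3) (by linear_combination c4)
      have kd := quint_kernel_minor_A1 (β (1, 3)) (β (1, 4)) d (by linear_combination d0) (by linear_combination d1)
        (by linear_combination d3) (by linear_combination d4)
      exact hminor (minors_eq_zero_of_prop _ _ _ (mul_ne_zero (by norm_num) (pow_ne_zero 2 hZ)) _ c d kc kd i₀ j₀)
  · rcases mul_eq_zero.mp hYVZ with hYV | hZ
    · rcases mul_eq_zero.mp hYV with hY' | hV
      · exact absurd hY' hY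
      · -- B1: `Y ≠ 0`, `V = 0`
        simp only [hV] at c0 c1 c2 c3 d0 d1 d2 d3
        have kc := quint_kernel_minor_B1 (β (0, 3)) (β (1, 3)) c (by linear_combination c0) (by linear_combination c1)
          (by linear_combination c2) (by linear_combination c3)
        have kd := quint_kernel_minor_B1 (β (0, 3)) (β (1, 3)) d (by linear_combination d0) (by linear_combination d1)
          (by linear_combination d2) (by linear_combination d3)
        exact hminor (minors_eq_zero_of_prop _ _ _ (pow_ne_zero 2 hY) _ c d kc kd i₀ j₀)
    · -- B2: `Y ≠ 0`, `Z = 0` (and `V` arbitrary)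
      simp only [hZ] at c0 c1 c2 c3 d0 d1 d2 d3
      have kc := quint_kernel_minor_B2 (β (0, 3)) (β (1, 4)) c (by linear_combination c0) (by linear_combination c1)
        (by linear_combination c2) (by linear_combination c3)
      have kd := quint_kernel_minor_B2 (β (0, 3)) (β (1, 4)) d (by linear_combination d0) (by linear_combination d1)
        (by linear_combination d2) (by linear_combination d3)
      exact hminor (minors_eq_zero_of_prop _ _ _ (mul_ne_zero (by norm_num) (pow_ne_zero 2 hY)) _ c d kc kd i₀ j₀)

end Summit.ValiantsHypothesis.ValiantsHypothesis.Theorems.LacunarySymmetroidMatrixDescartes.WallBubbling
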